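import Mathlib
import Literature.MathematicalPhysics.StatisticalMechanics.BarlowStacking
import Literature.MathematicalPhysics.StatisticalMechanics.LennardJonesClusters
import Literature.MathematicalPhysics.StatisticalMechanics.MuGroundStateConfiguration

/-!
# Compactness extraction: a small local defect functional forces a near-Barlow patch

Stub `stub_compactnessExtraction` of the line `sharp-m-potential-compactness` for the crux
`PricedLinkCensus.TruncatedCensusGap` (item stmt-AtomisticToContinuum-14230), registered by
`ledger skeleton check` on `Cruxes/TruncatedCensusGap/Lines/sharp_m_potential_compactness.lean`.
The final statement is the registered signature VERBATIM (self-contained over tree declarations).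

Pure analysis, the twin of `PricedLinkCensusTruncatedCensusGapKnabeCompactness.lean`: a site
functional `H` on finite configurations of `ℝ³` that is `R`-local under rigid motions,
uniformly continuous under `θ`-matchings of tame (`r₀`-separated) `R`-patches, non-negative, and
whose zeros on tame patches are, for every `δ > 0`, two-way `δa`-matched within `4a ≤ R` of the
root to a rigid image of a Barlow stacking (`0.812a ≤ c ≤ 0.821a`), is `< κ(δ)` on a tame patch
only if that patch is `δa`-matched within `3a` of the root to a rigid Barlow stacking.

Route.  `R < 0`: locality alone makes `H` one constant on injective rooted configurations, and
the zero-set clause (`0 < a`, `4a ≤ R`) makes that constant positive.  `0 ≤ R`: restrict to the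
closed `R`-patch of the root and translate the root to `0` (locality); the patch is
`r₀`-separated in a ball of radius `R`, so its size is bounded by packing
(`card_le_of_separated_of_dist_le`); for each size `M` and root index argue by contradiction with
Bolzano–Weierstrass on `(closedBall 0 R)^M`: the limit configuration is `r₀`-separated, `H = 0`
there by tame continuity and non-negativity, hence it is near-Barlow at every accuracy, and
near-Barlow data pass to sitewise close configurations (`nearBarlow_of_close`, by the uniform
discreteness of Barlow stackings) and back to the unrestricted patch (`nearBarlow_of_restrict`).
-/

noncomputable section

namespace Summit.AtomisticToContinuum.Crystallization.Theorems.PricedLinkCensusTruncatedCensusGap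

open scoped BigOperators Topology
open Filter Literature.MathematicalPhysics.StatisticalMechanics

-- adapted from `exists_pos_le_of_finite` in `PricedLinkCensusTruncatedCensusGapKnabeCompactness`
/-- A positive real function on a finite type admits a uniform positive lower bound. -/
private theorem exists_pos_le_of_finite {ι : Type*} [Finite ι] (f : ι → ℝ) (hf : ∀ x, 0 < f x) :
    ∃ κ : ℝ, 0 < κ ∧ ∀ x, κ ≤ f x := by
  rcases isEmpty_or_nonempty ι with hι | hι
  · exact ⟨1, one_pos, fun x => (IsEmpty.false x).elim⟩
  · obtain ⟨x₀, hx₀⟩ := Finite.exists_min f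
    exact ⟨f x₀, hf x₀, hx₀⟩

/-- Distinct points of a rigid image of a Barlow stacking are at distance `≥ min a c`. -/
private theorem le_dist_of_mem_image_barlowStacking {a c : ℝ} {s : ℤ → ℤ}
    (g : EuclideanSpace ℝ (Fin 3) ≃ᵃⁱ[ℝ] EuclideanSpace ℝ (Fin 3)) (ha : 0 ≤ a) (hc : 0 ≤ c)
    {p q : EuclideanSpace ℝ (Fin 3)} (hp : p ∈ g '' barlowStacking a c s)
    (hq : q ∈ g '' barlowStacking a c s) (hpq : p ≠ q) : min a c ≤ dist p q := by
  obtain ⟨p', hp', rfl⟩ := hp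
  obtain ⟨q', hq', rfl⟩ := hq
  rw [g.dist_map]
  exact le_dist_of_mem_barlowStacking a c s ha hc hp' hq' fun h => hpq (by rw [h])

/-- **Perturbative transfer of near-Barlow data.** If `x` is `a/2`-separated within `4a` of
`x r` and two-way `δ'a`-matched within `4a` of `x r` with the rigid Barlow image
`g '' barlowStacking a c s` (`0.812a ≤ c`, `δ'a ≤ a/100`), then every configuration `w` that is
sitewise `ε`-close to `x` (`ε ≤ a/100`, `δ'a + ε ≤ δa`) is `a/2`-separated within `3a` of `w r`
and two-way `δa`-matched within `3a` of `w r` with the same image. -/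
private theorem nearBarlow_of_close {M : ℕ} {x w : Fin M → EuclideanSpace ℝ (Fin 3)} {r : Fin M}
    {a c δ δ' ε : ℝ} {s : ℤ → ℤ}
    {g : EuclideanSpace ℝ (Fin 3) ≃ᵃⁱ[ℝ] EuclideanSpace ℝ (Fin 3)}
    (ha : 0 < a) (hc : 812 / 1000 * a ≤ c) (hδ' : δ' * a ≤ a / 100) (hεδ : δ' * a + ε ≤ δ * a)
    (hεa : ε ≤ a / 100)
    (hsep : ∀ j k : Fin M, j ≠ k → dist (x j) (x r) ≤ 4 * a → a / 2 ≤ dist (x j) (x k))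
    (hbm : BallMatch (δ' * a) (4 * a) (x r) (Set.range x) (g '' barlowStacking a c s))
    (hclose : ∀ j, dist (w j) (x j) ≤ ε) :
    (∀ j k : Fin M, j ≠ k → dist (w j) (w r) ≤ 3 * a → a / 2 ≤ dist (w j) (w k)) ∧
    BallMatch (δ * a) (3 * a) (w r) (Set.range w) (g '' barlowStacking a c s) := by
  -- a site of `w` within `3a` of `w r` comes from a site of `x` within `3a + 2ε ≤ 4a` of `x r`
  have hxw : ∀ j, dist (w j) (w r) ≤ 3 * a → dist (x j) (x r) ≤ 3 * a + 2 * ε := by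
    intro j hj
    have h1 : dist (x j) (x r) ≤ dist (x j) (w j) + dist (w j) (w r) + dist (w r) (x r) :=
      dist_triangle4 _ _ _ _
    rw [dist_comm (x j) (w j)] at h1
    linarith [hclose j, hclose r]
  have h4a : ∀ j, dist (w j) (w r) ≤ 3 * a → dist (x j) (x r) ≤ 4 * a := fun j hj => by
    linarith [hxw j hj]
  have e1 : ∀ j q, dist (w j) q ≤ dist (x j) q + ε := fun j q => by
    linarith [dist_triangle (w j) (x j) q, hclose j]
  refine ⟨?_, ?_, ?_⟩
  · intro j k hjk hj
    have hjk' : dist (x j) (x k) ≤ dist (w j) (w k) + 2 * ε := by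
      have h1 : dist (x j) (x k) ≤ dist (x j) (w j) + dist (w j) (w k) + dist (w k) (x k) :=
        dist_triangle4 _ _ _ _
      rw [dist_comm (x j) (w j)] at h1
      linarith [hclose j, hclose k]
    have hxjk : a / 2 ≤ dist (x j) (x k) := hsep j k hjk (h4a j hj)
    by_cases hk : dist (x k) (x r) ≤ 4 * a
    · -- both sites are `δ'a`-close to distinct points of the rigid Barlow image
      obtain ⟨p, hp, hjp⟩ := hbm.2 (x j) ⟨j, rfl⟩ (h4a j hj)
      obtain ⟨q, hq, hkq⟩ := hbm.2 (x k) ⟨k, rfl⟩ hk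
      have hpq : p ≠ q := by
        rintro rfl
        linarith [dist_triangle_right (x j) (x k) p]
      have h1 : min a c ≤ dist p q :=
        le_dist_of_mem_image_barlowStacking g ha.le (by linarith) hp hq hpq
      have h2 : 812 / 1000 * a ≤ min a c := le_min (by linarith) hc
      have h3 : dist p q ≤ dist p (x j) + dist (x j) (x k) + dist (x k) q :=
        dist_triangle4 _ _ _ _
      rw [dist_comm p (x j)] at h3
      linarith
    · -- `x k` is far from the root
      rw [not_le] at hk
      linarith [dist_triangle (x k) (x j) (x r), dist_comm (x j) (x k), hxw j hj]
  · intro q hq hqr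
    have h1 : dist q (x r) ≤ 4 * a := by
      linarith [dist_triangle q (w r) (x r), hclose r]
    obtain ⟨p, ⟨j, rfl⟩, hjq⟩ := hbm.1 q hq h1
    exact ⟨w j, ⟨j, rfl⟩, by linarith [e1 j q]⟩
  · rintro p ⟨j, rfl⟩ hj
    obtain ⟨q, hq, hjq⟩ := hbm.2 (x j) ⟨j, rfl⟩ (h4a j hj)
    exact ⟨q, hq, by linarith [e1 j q]⟩

/-- **Un-restriction.** Near-Barlow data within `3a` of the root of the restricted, rigidly
moved patch `x = t ∘ y ∘ f` (`f` reaching every site of `y` within `R` of `y i`, `f i' = i`,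
`4a ≤ R`) give near-Barlow data within `3a` of `y i` for `y` itself, with the rigid motion
`g.trans t.symm`. -/
private theorem nearBarlow_of_restrict {N M : ℕ} {y : Fin N → EuclideanSpace ℝ (Fin 3)}
    {i : Fin N} {x : Fin M → EuclideanSpace ℝ (Fin 3)} {i' : Fin M} {f : Fin M → Fin N}
    {t g : EuclideanSpace ℝ (Fin 3) ≃ᵃⁱ[ℝ] EuclideanSpace ℝ (Fin 3)} {R a δ : ℝ}
    {B : Set (EuclideanSpace ℝ (Fin 3))}
    (hx : ∀ j', x j' = t (y (f j'))) (hi : f i' = i)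
    (hf : ∀ j, dist (y j) (y i) ≤ R → ∃ j', f j' = j) (ha : 0 < a) (h4a : 4 * a ≤ R)
    (hsep : ∀ j k : Fin M, j ≠ k → dist (x j) (x i') ≤ 3 * a → a / 2 ≤ dist (x j) (x k))
    (hbm : BallMatch (δ * a) (3 * a) (x i') (Set.range x) (g '' B)) :
    (∀ j k : Fin N, j ≠ k → dist (y j) (y i) ≤ 3 * a → a / 2 ≤ dist (y j) (y k)) ∧
    BallMatch (δ * a) (3 * a) (y i) (Set.range y) ((g.trans t.symm) '' B) := by
  have hxi : x i' = t (y i) := by rw [hx, hi]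
  have hdx : ∀ j' k', dist (x j') (x k') = dist (y (f j')) (y (f k')) := fun j' k' => by
    rw [hx, hx, t.dist_map]
  have hdi : ∀ j', dist (x j') (x i') = dist (y (f j')) (y i) := fun j' => by rw [hdx, hi]
  have e1 : ∀ (p : EuclideanSpace ℝ (Fin 3)) (z : EuclideanSpace ℝ (Fin 3)),
      dist p ((g.trans t.symm) z) = dist (t p) (g z) := fun p z => by
    rw [AffineIsometryEquiv.coe_trans, Function.comp_apply, ← t.dist_map p (t.symm (g z)),
      t.apply_symm_apply]
  refine ⟨?_, ?_, ?_⟩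
  · intro j k hjk hj
    obtain ⟨j', rfl⟩ := hf j (by linarith)
    by_cases hk : dist (y k) (y i) ≤ R
    · obtain ⟨k', rfl⟩ := hf k hk
      have h1 := hsep j' k' (fun h => hjk (by rw [h])) (by rwa [hdi])
      rwa [hdx] at h1
    · rw [not_le] at hk
      linarith [dist_triangle (y k) (y (f j')) (y i), dist_comm (y (f j')) (y k)]
  · rintro q ⟨z, hz, rfl⟩ hq
    have h1 : dist (g z) (x i') ≤ 3 * a := by rwa [hxi, dist_comm, ← e1, dist_comm]
    obtain ⟨p, ⟨j', rfl⟩, hj⟩ := hbm.1 (g z) ⟨z, hz, rfl⟩ h1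
    exact ⟨y (f j'), ⟨f j', rfl⟩, by rw [e1, ← hx]; exact hj⟩
  · rintro p ⟨j, rfl⟩ hj
    obtain ⟨j', rfl⟩ := hf j (by linarith)
    obtain ⟨q, ⟨z, hz, rfl⟩, hq⟩ := hbm.2 (x j') ⟨j', rfl⟩ (by rwa [hdi])
    exact ⟨(g.trans t.symm) z, ⟨z, hz, rfl⟩, by rw [e1, ← hx]; exact hq⟩

/-- **Compactness extraction** (the Peierls constant by compactness, abstract form). Let `H` be a site functional on finite configurations of `ℝ³` that is `R`-local under rigid motions, uniformly continuous under `θ`-matchings of `r₀`-separated (tame) `R`-patches, non-negative, and whose zeros on tame patches are, for every `δ > 0`, `a/2`-separated and two-way `δa`-matched within `4a ≤ R` of the root with a rigid Barlow stacking (`0.812a ≤ c ≤ 0.821a`). Then for every `δ > 0` there is `κ > 0` such that every tame site with `H < κ` is `a/2`-separated and two-way `δa`-matched within `3a` of the root with a rigid Barlow stacking. [folklore] -/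
theorem stub_compactnessExtraction :
    ∀ (R r₀ : ℝ) (H : (N : ℕ) → (Fin N → EuclideanSpace ℝ (Fin 3)) → Fin N → ℝ), 0 < r₀ →
      (∀ (N N' : ℕ) (y : Fin N → EuclideanSpace ℝ (Fin 3)) (y' : Fin N' → EuclideanSpace ℝ (Fin 3))
          (i : Fin N) (i' : Fin N')
          (g : EuclideanSpace ℝ (Fin 3) ≃ᵃⁱ[ℝ] EuclideanSpace ℝ (Fin 3)),
        Function.Injective y → Function.Injective y' → g (y i) = y' i' →
        (∀ j : Fin N, dist (y j) (y i) ≤ R → g (y j) ∈ Set.range y') →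
        (∀ j' : Fin N', dist (y' j') (y' i') ≤ R → y' j' ∈ g '' Set.range y) →
        H N y i = H N' y' i') →
      (∀ ε : ℝ, 0 < ε → ∃ θ : ℝ, 0 < θ ∧
        ∀ (N N' : ℕ) (y : Fin N → EuclideanSpace ℝ (Fin 3)) (y' : Fin N' → EuclideanSpace ℝ (Fin 3))
          (i : Fin N) (i' : Fin N')
          (g : EuclideanSpace ℝ (Fin 3) ≃ᵃⁱ[ℝ] EuclideanSpace ℝ (Fin 3)),
          Function.Injective y → Function.Injective y' →
          (∀ j k : Fin N, j ≠ k → dist (y j) (y i) ≤ R → dist (y k) (y i) ≤ R →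
            r₀ ≤ dist (y j) (y k)) →
          (∀ j k : Fin N', j ≠ k → dist (y' j) (y' i') ≤ R → dist (y' k) (y' i') ≤ R →
            r₀ ≤ dist (y' j) (y' k)) →
          g (y i) = y' i' →
          (∃ e : {j : Fin N // dist (y j) (y i) ≤ R} ≃ {j' : Fin N' // dist (y' j') (y' i') ≤ R},
            ∀ j, dist (g (y j.1)) (y' (e j).1) ≤ θ) →
          |H N y i - H N' y' i'| ≤ ε) →
      (∀ (N : ℕ) (y : Fin N → EuclideanSpace ℝ (Fin 3)) (i : Fin N), Function.Injective y →
        0 ≤ H N y i) →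
      (∀ (N : ℕ) (y : Fin N → EuclideanSpace ℝ (Fin 3)) (i : Fin N), Function.Injective y →
        (∀ j k : Fin N, j ≠ k → dist (y j) (y i) ≤ R → dist (y k) (y i) ≤ R →
          r₀ ≤ dist (y j) (y k)) →
        H N y i = 0 → ∀ δ : ℝ, 0 < δ →
          ∃ (a c : ℝ) (s : ℤ → ℤ) (g : EuclideanSpace ℝ (Fin 3) ≃ᵃⁱ[ℝ] EuclideanSpace ℝ (Fin 3)),
            0 < a ∧ 4 * a ≤ R ∧ 812 / 1000 * a ≤ c ∧ c ≤ 821 / 1000 * a ∧ IsHaggSeq s ∧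
            (∀ j k : Fin N, j ≠ k → dist (y j) (y i) ≤ 4 * a → a / 2 ≤ dist (y j) (y k)) ∧
            BallMatch (δ * a) (4 * a) (y i) (Set.range y) (g '' barlowStacking a c s)) →
      ∀ δ : ℝ, 0 < δ → ∃ κ : ℝ, 0 < κ ∧
        ∀ (N : ℕ) (y : Fin N → EuclideanSpace ℝ (Fin 3)) (i : Fin N), Function.Injective y →
          (∀ j k : Fin N, j ≠ k → dist (y j) (y i) ≤ R → dist (y k) (y i) ≤ R →
            r₀ ≤ dist (y j) (y k)) →
          H N y i < κ →
          ∃ (a c : ℝ) (s : ℤ → ℤ) (g : EuclideanSpace ℝ (Fin 3) ≃ᵃⁱ[ℝ] EuclideanSpace ℝ (Fin 3)),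
            0 < a ∧ 812 / 1000 * a ≤ c ∧ c ≤ 821 / 1000 * a ∧ IsHaggSeq s ∧
            (∀ j k : Fin N, j ≠ k → dist (y j) (y i) ≤ 3 * a → a / 2 ≤ dist (y j) (y k)) ∧
            BallMatch (δ * a) (3 * a) (y i) (Set.range y) (g '' barlowStacking a c s) := by
  intro R r₀ H hr₀ hloc hcont hnn hzero δ hδ
  obtain hR | hR : R < 0 ∨ 0 ≤ R := lt_or_ge R 0
  · /- `R < 0`: all patches are empty, so locality makes `H` one constant on injective rooted
    configurations, and the zero-set clause (`0 < a`, `4a ≤ R`) makes that constant positive. -/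
    have hinj₀ : Function.Injective (fun _ : Fin 1 => (0 : EuclideanSpace ℝ (Fin 3))) :=
      Function.injective_of_subsingleton _
    have hconst : ∀ (N : ℕ) (y : Fin N → EuclideanSpace ℝ (Fin 3)) (i : Fin N),
        Function.Injective y → H N y i = H 1 (fun _ => 0) 0 := by
      intro N y i hy
      refine hloc N 1 y _ i 0 (AffineIsometryEquiv.vaddConst ℝ (y i)).symm hy hinj₀ (by simp)
        (fun j hj => ?_) (fun j' hj' => ?_)
      · exact (not_le.2 (hR.trans_le dist_nonneg) hj).elim
      · exact (not_le.2 (hR.trans_le dist_nonneg) hj').elim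
    have hpos : 0 < H 1 (fun _ => 0) 0 := by
      refine lt_of_le_of_ne (hnn 1 _ 0 hinj₀) fun h0 => ?_
      obtain ⟨a, c, s, g, ha, h4a, -⟩ := hzero 1 _ 0 hinj₀
        (fun j k hjk _ _ => absurd (Subsingleton.elim j k) hjk) h0.symm 1 one_pos
      linarith
    exact ⟨_, hpos, fun N y i hy _ hlt => absurd (hconst N y i hy) hlt.ne⟩
  -- `0 ≤ R`: the near-Barlow predicate of the goal strengthened by `4 * a ≤ R`, named once
  obtain ⟨NB, hNB⟩ : ∃ NB : (M : ℕ) → (Fin M → EuclideanSpace ℝ (Fin 3)) → Fin M → Prop,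
      ∀ M y i, NB M y i ↔
        ∃ (a c : ℝ) (s : ℤ → ℤ) (g : EuclideanSpace ℝ (Fin 3) ≃ᵃⁱ[ℝ] EuclideanSpace ℝ (Fin 3)),
          0 < a ∧ 4 * a ≤ R ∧ 812 / 1000 * a ≤ c ∧ c ≤ 821 / 1000 * a ∧ IsHaggSeq s ∧
          (∀ j k : Fin M, j ≠ k → dist (y j) (y i) ≤ 3 * a → a / 2 ≤ dist (y j) (y k)) ∧
          BallMatch (δ * a) (3 * a) (y i) (Set.range y) (g '' barlowStacking a c s) :=
    ⟨_, fun _ _ _ => Iff.rfl⟩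
  /- Step 1 (Bolzano–Weierstrass): for each patch size `M` and root `r` there is `κ > 0` such
  that `r₀`-separated configurations in `closedBall 0 R` rooted at `0` with `H < κ` satisfy `NB`. -/
  have claim : ∀ (M : ℕ) (r : Fin M), ∃ κ : ℝ, 0 < κ ∧
      ∀ x : Fin M → EuclideanSpace ℝ (Fin 3), x r = 0 → (∀ j, dist (x j) 0 ≤ R) →
        (∀ j k, j ≠ k → r₀ ≤ dist (x j) (x k)) → H M x r < κ → NB M x r := by
    intro M r
    -- separation gives injectivity and tameness
    have hinj : ∀ x : Fin M → EuclideanSpace ℝ (Fin 3),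
        (∀ j k, j ≠ k → r₀ ≤ dist (x j) (x k)) → Function.Injective x := by
      intro x hs j k hjk
      by_contra hne
      have h1 := hs j k hne
      rw [hjk, dist_self] at h1
      exact absurd h1 (not_le.mpr hr₀)
    have htame : ∀ x : Fin M → EuclideanSpace ℝ (Fin 3),
        (∀ j k, j ≠ k → r₀ ≤ dist (x j) (x k)) →
        ∀ j k : Fin M, j ≠ k → dist (x j) (x r) ≤ R → dist (x k) (x r) ≤ R →
          r₀ ≤ dist (x j) (x k) := fun x hs j k hjk _ _ => hs j k hjk
    by_contra hcon
    have hseq : ∀ n : ℕ, ∃ x : Fin M → EuclideanSpace ℝ (Fin 3), x r = 0 ∧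
        (∀ j, dist (x j) 0 ≤ R) ∧ (∀ j k, j ≠ k → r₀ ≤ dist (x j) (x k)) ∧
        H M x r < 1 / ((n : ℝ) + 1) ∧ ¬ NB M x r := by
      intro n
      by_contra hn
      refine hcon ⟨1 / ((n : ℝ) + 1), by positivity, fun x h0 hb hs hlt => ?_⟩
      by_contra hnb
      exact hn ⟨x, h0, hb, hs, hlt, hnb⟩
    choose x hx0 hxb hxs hxh hxn using hseq
    -- a convergent subsequence in the compact box `(closedBall 0 R)^M`
    have hC : IsCompact (Set.pi Set.univ
        fun _ : Fin M => Metric.closedBall (0 : EuclideanSpace ℝ (Fin 3)) R) :=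
      isCompact_univ_pi fun _ => isCompact_closedBall _ _
    obtain ⟨z, -, φ, hφ, hlim⟩ := hC.tendsto_subseq
      fun n => Set.mem_univ_pi.2 fun j => Metric.mem_closedBall.2 (hxb n j)
    have hcoord : ∀ j, Tendsto (fun n => x (φ n) j) atTop (𝓝 (z j)) :=
      fun j => ((continuous_apply j).tendsto z).comp hlim
    have hz0 : z r = 0 :=
      tendsto_nhds_unique (hcoord r) (by simp only [hx0]; exact tendsto_const_nhds)
    have hzb : ∀ j, dist (z j) 0 ≤ R := fun j =>
      le_of_tendsto' ((hcoord j).dist tendsto_const_nhds) fun n => hxb (φ n) j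
    have hzs : ∀ j k, j ≠ k → r₀ ≤ dist (z j) (z k) := fun j k hjk =>
      ge_of_tendsto' ((hcoord j).dist (hcoord k)) fun n => hxs (φ n) j k hjk
    have hzinj : Function.Injective z := hinj z hzs
    -- tame continuity and non-negativity: `H M z r = 0`
    have hH0 : H M z r = 0 := by
      refine le_antisymm (le_of_forall_pos_le_add fun ε hε => ?_) (hnn M z r hzinj)
      obtain ⟨θ, hθ, hθP⟩ := hcont (ε / 2) (half_pos hε)
      have h1 : ∀ᶠ n in atTop, dist (x (φ n)) z < θ := Metric.tendsto_nhds.1 hlim θ hθ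
      have h2 : ∀ᶠ n : ℕ in atTop, 1 / ((n : ℝ) + 1) < ε / 2 :=
        (tendsto_order.1 tendsto_one_div_add_atTop_nhds_zero_nat).2 _ (half_pos hε)
      obtain ⟨n, hn1, hn2⟩ := (h1.and h2).exists
      have h3 : |H M (x (φ n)) r - H M z r| ≤ ε / 2 := by
        refine hθP M M (x (φ n)) z r r (AffineIsometryEquiv.refl ℝ _) (hinj _ (hxs _)) hzinj
          (htame _ (hxs _)) (htame z hzs) (by simp [hx0, hz0])
          ⟨Equiv.subtypeEquivRight fun j => ?_, fun j => ?_⟩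
        · rw [hx0, hz0]
          exact iff_of_true (hxb _ j) (hzb j)
        · simp only [Equiv.subtypeEquivRight_apply_coe, AffineIsometryEquiv.coe_refl, id_eq]
          exact (dist_le_pi_dist (x (φ n)) z j.1).trans hn1.le
      have h4 : 1 / ((φ n : ℝ) + 1) ≤ 1 / ((n : ℝ) + 1) := by
        gcongr
        exact_mod_cast hφ.le_apply
      obtain ⟨h3a, -⟩ := abs_le.1 h3
      linarith [hxh (φ n)]
    -- near-Barlow data at the limit, at accuracy `min (δ/2) (1/100)`, pass to a nearby term
    obtain ⟨a, c, s, g, ha, h4a, hc1, hc2, hs, hsep4, hbm⟩ :=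
      hzero M z r hzinj (htame z hzs) hH0 (min (δ / 2) (1 / 100))
        (lt_min (by positivity) (by positivity))
    obtain ⟨n₀, hn₀⟩ := Metric.tendsto_atTop.1 hlim (min (δ * a / 2) (a / 100))
      (lt_min (by positivity) (by positivity))
    have hclose : ∀ j, dist (x (φ n₀) j) (z j) ≤ min (δ * a / 2) (a / 100) := fun j =>
      (dist_le_pi_dist _ _ j).trans (hn₀ n₀ le_rfl).le
    have hδ' : min (δ / 2) (1 / 100) * a ≤ a / 100 :=
      calc min (δ / 2) (1 / 100) * a ≤ 1 / 100 * a :=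
            mul_le_mul_of_nonneg_right (min_le_right _ _) ha.le
        _ = a / 100 := by ring
    have hεδ : min (δ / 2) (1 / 100) * a + min (δ * a / 2) (a / 100) ≤ δ * a :=
      calc min (δ / 2) (1 / 100) * a + min (δ * a / 2) (a / 100) ≤ δ / 2 * a + δ * a / 2 :=
            add_le_add (mul_le_mul_of_nonneg_right (min_le_left _ _) ha.le) (min_le_left _ _)
        _ = δ * a := by ring
    obtain ⟨hsep3, hbm3⟩ :=
      nearBarlow_of_close ha hc1 hδ' hεδ (min_le_right _ _) hsep4 hbm hclose
    exact hxn (φ n₀) ((hNB _ _ _).2 ⟨a, c, s, g, ha, h4a, hc1, hc2, hs, hsep3, hbm3⟩)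
  /- Step 2: one constant for all patch sizes `M ≤ K` (the packing bound) and all roots. -/
  obtain ⟨K, hK⟩ : ∃ K : ℕ, K = ⌊(2 * R / r₀ + 1) ^ 3⌋₊ := ⟨_, rfl⟩
  choose κ hκpos hκP using claim
  obtain ⟨κ₁, hκ₁, hκ₁le⟩ := exists_pos_le_of_finite
    (fun x : (Σ m : Fin (K + 1), Fin (m : ℕ)) => κ (x.1 : ℕ) x.2) fun x => hκpos x.1 x.2
  refine ⟨κ₁, hκ₁, ?_⟩
  intro N y i hy htame hlt
  /- Step 3: the closed `R`-patch of `i` is an `r₀`-separated subset of a ball of radius `R`,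
  of size `≤ K`; enumerate it, translate `y i` to the origin, and use locality. -/
  obtain ⟨S, hmemS⟩ : ∃ S : Finset (Fin N), ∀ j, j ∈ S ↔ dist (y j) (y i) ≤ R :=
    ⟨Finset.univ.filter fun j => dist (y j) (y i) ≤ R, fun j => by simp⟩
  have hSsep : ∀ j ∈ S, ∀ k ∈ S, j ≠ k → r₀ ≤ dist (y j) (y k) := fun j hj k hk hjk =>
    htame j k hjk ((hmemS j).1 hj) ((hmemS k).1 hk)
  have hcard : S.card < K + 1 := by
    have h1 := card_le_of_separated_of_dist_le (S.image y) (y i) hr₀ hR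
      (fun c hc => ?_) (fun c hc d hd hcd => ?_)
    · rw [Finset.card_image_of_injective S hy, finrank_euclideanSpace_fin] at h1
      rw [hK, Nat.lt_add_one_iff]
      exact Nat.le_floor h1
    · obtain ⟨j, hj, rfl⟩ := Finset.mem_image.1 hc
      exact (hmemS j).1 hj
    · obtain ⟨j, hj, rfl⟩ := Finset.mem_image.1 hc
      obtain ⟨k, hk, rfl⟩ := Finset.mem_image.1 hd
      exact hSsep j hj k hk fun hjk => hcd (by rw [hjk])
  -- enumerate `S`
  obtain ⟨f, hrange⟩ : ∃ f : Fin S.card ↪ Fin N, Set.range f = (S : Set (Fin N)) :=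
    ⟨(S.orderEmbOfFin rfl).toEmbedding, Finset.range_orderEmbOfFin S rfl⟩
  have hmemf : ∀ j, j ∈ Set.range f ↔ dist (y j) (y i) ≤ R := fun j => by
    rw [hrange, Finset.mem_coe, hmemS]
  have hfR : ∀ j', dist (y (f j')) (y i) ≤ R := fun j' => (hmemf _).1 (Set.mem_range_self j')
  obtain ⟨i', hi'⟩ : i ∈ Set.range f := (hmemf i).2 (by rw [dist_self]; exact hR)
  -- translate the root to the origin
  obtain ⟨t, ht0⟩ :
      ∃ t : EuclideanSpace ℝ (Fin 3) ≃ᵃⁱ[ℝ] EuclideanSpace ℝ (Fin 3), t (y i) = 0 :=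
    ⟨(AffineIsometryEquiv.vaddConst ℝ (y i)).symm, by simp⟩
  obtain ⟨x, hx⟩ : ∃ x : Fin S.card → EuclideanSpace ℝ (Fin 3), ∀ j', x j' = t (y (f j')) :=
    ⟨_, fun _ => rfl⟩
  have hxi' : x i' = 0 := by rw [hx, hi', ht0]
  have hxinj : Function.Injective x := fun j' k' h => by
    rw [hx, hx] at h
    exact f.injective (hy (t.injective h))
  have hxb : ∀ j', dist (x j') 0 ≤ R := fun j' => by
    rw [hx, ← ht0, t.dist_map]; exact hfR j'
  have hxs : ∀ j' k', j' ≠ k' → r₀ ≤ dist (x j') (x k') := fun j' k' hjk => by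
    rw [hx, hx, t.dist_map]
    exact htame _ _ (f.injective.ne hjk) (hfR j') (hfR k')
  -- locality: `H` of `y` at `i` is `H` of the translated patch at `i'`
  have hHx : H N y i = H S.card x i' := by
    refine hloc N S.card y x i i' t hy hxinj (by rw [hxi', ht0]) (fun j hj => ?_)
      (fun j' _ => ⟨y (f j'), ⟨f j', rfl⟩, (hx j').symm⟩)
    obtain ⟨j', rfl⟩ := (hmemf j).2 hj
    exact ⟨j', hx j'⟩
  /- Step 4: the compactness constant of `(S.card, i')` applies; un-restrict. -/
  have hk₁ : κ₁ ≤ κ S.card i' := hκ₁le ⟨⟨S.card, hcard⟩, i'⟩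
  obtain ⟨a, c, s, g, ha, h4a, hc1, hc2, hs, hsep3, hbm3⟩ :=
    (hNB _ _ _).1 (hκP S.card i' x hxi' hxb hxs (by rw [← hHx]; exact hlt.trans_le hk₁))
  obtain ⟨hsep, hbm⟩ :=
    nearBarlow_of_restrict hx hi' (fun j hj => (hmemf j).2 hj) ha h4a hsep3 hbm3
  exact ⟨a, c, s, g.trans t.symm, ha, hc1, hc2, hs, hsep, hbm⟩

end Summit.AtomisticToContinuum.Crystallization.Theorems.PricedLinkCensusTruncatedCensusGap

end
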